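import Literature.MathematicalPhysics.QuantumFieldTheory.Balaban1983to89.B9Eq343GreenPrimeDstarTwoBackgroundHolderLetter
import Literature.MathematicalPhysics.QuantumFieldTheory.Balaban1983to89.B9Eq3152RkGpDstarPiTwoBackgroundLetterTower
import Literature.MathematicalPhysics.QuantumFieldTheory.Balaban1983to89.B9Eq340WeightedHolderRowsProjectionStep

/-!
# `Balaban1983to89.B9Eq3152RkGpDstarPiTwoBackgroundHolderLetter` — T. Bałaban, *Propagators for lattice gauge theories in a background field*, CMP **99** (1985) 389–434
# [Balaban1985BackgroundPropagators] (3.152)–(3.153) p. 426 (*«RD\*G₁ = RG′D\*»*), (3.25) p. 394 (`R = I − G′Q′*(Q′G′²Q′*)⁻¹Q′G′`), (3.68) p. 403, Thm 3.4 p. 400, Thm 3.1 (3.42)–(3.43),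
# (3.40), (3.47) pp. 397–398: **THE INNER SITE FUNCTION `ω = R_kG′_kD*_U f` OF THE THIRD WORD OF PRINT's `𝔊̃_k`, TWO-BACKGROUND LADDER AT THE FLAT BASE, η-HÖLDER MEMBER** —
# for one-block fine-bond sources `f` over the coarse block `v` (`‖f‖_∞ ≤ F`) and fine sites `y, y′` with `dist(y, y′) ≤ L^{n+1}`:
# `‖(ω(U) − ω(1))(y′) − (ω(U) − ω(1))(y)‖ ≤ (j₀ + α)·K·e^{−κ d_m(Πy, v)}·(dist(y,y′)∕L^{n+1})^{½}·F`, constants BEFORE `n, η, m, U` — the letter `Hω` of this lineage's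
# `B9Eq3152ThirdWordPiTwoBackgroundGradLetterOfOmegaHolder` (`H3 ⇐ Hω`), now DISCHARGED on the model.  Road (the `R_k`-step): `ω(U) − ω(1) = (R_k(U) − R_k(1))y(U) +
# [(y(U) − y(1)) − W_k(1)(y(U) − y(1))]`, `y(V) = G′_k(V)D*_Vf`, `W_k(1) = 1 − R_k(1)`; term one = the two-background LOCAL letters of `R_k(U) − R_k(1)` (value: gen 100's ladder
# majorant `B9Eq368TowerProjLadderClosed` read back by gen 99's seam; flat gradient: `B9Eq368TowerProjWordGradientLetters.exists_gradLetter_RofUk_sub_flat`) on the DECAYING datum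
# `y(U)` (`B9Eq342GreenPrimeDstarValueRowTower`) by `B9Eq340WeightedHolderRowsProjectionStep.weighted_row_of_local` twice + `B9Eq340HolderRowOfGradientRow` (a Lipschitz field at the
# unit scale is Hölder); term two = the projection step `B9Eq340WeightedHolderRowsProjectionStep.weightedHolderRows_sub_of_localLetters` with `X := W_k(1)` (value letter: ne9-leaf-05's
# `B9Eq325RofUkSupRowClosed`; flat gradient letter: `exists_gradLetter_W_one`) on the two-background Hölder field `y(U) − y(1)` of gen 103's `B9Eq343GreenPrimeDstarTwoBackgroundHolderLetter`
# (factor `α`).  NE9 crux-team LEAF PROVER 01 (`b2b-balaban-t4-ne9-formalise-leaf-01`), gen 104; cell `pub-balaban`∕`t4`, row NE9, bears_on R4/N22; source READ first-hand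
# (pp. 394–403, 425–426); composition BY NAME; nothing printed is a hypothesis.
# WHAT IS PROVED (sorry-free; proof lane — 0 `def`): **`exists_holderLetter_RkGpDstar_sub_flat`** (the statement `Hω` VERBATIM).  HONEST SCOPE: letters on the cell's MODEL (O-NE9-1, #5
# UNRULED); constants crude; `j₀` enters only as `α ≤ j₀ + α`; the windows, `c₀ = η^d`, unitarity, the tower data, the positivity and onto witnesses stay HYPOTHESES (most unused here);
# nothing of [B9] (3.152)–(3.153), Thm 3.1∕3.4 or [B11] (117) asserted as printed; «NE9 ⇐ the named binders»; NE9 NOT PRINTED ∕ NOT PROVED; spine PROVED 0∕9; rung (B)+1 finite T⁴ —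
# NOT infinite volume, NOT mass gap, NOT BetaPertH, NOT Clay.  HONEST DEPENDENCY: continuum YM on T⁴ ⇐ BetaPertH ∧ nine spine estimates (0/9 proved); BetaPertH ⇐ (D1) ∧ (D4) ∧
# CAP+tail; G-an2-4 gates asym, D1 and NE2/3/4.  NEW file; nothing modified.  Net new unproved facts: 0.

statement-level skeleton of published theorems with citation tags; proofs where landed; nothing here is a claim about the Yang–Mills mass gap
-/


noncomputable section

open scoped InnerProductSpace ComplexConjugate BigOperators

namespace Literature.MathematicalPhysics.QuantumFieldTheory.Balaban1983to89.B9Eq3152RkGpDstarPiTwoBackgroundHolderLetter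

open B4Sect5Torus (TSite tdist tdist_nonneg tdist_triangle tdist_symm torusSum_le tdist_self)
open B4Sect5Proof (latticeConst latticeConst_nonneg)
open B9SectCLatticeCarrier (Bond bpos btgt shift unshift shift_unshift)
open B9Eq311L2Pairing (WL2)
open B9Eq319QprimeTorus (blockCoord)
open B7Prop1Explicit (U1 Wcx boxVec)
open B11Eq103H1Complex (SiteL2K BondL2K covDerivL2K covDivL2K equiv_covDerivL2K)
open B9Eq33CovDerivVector (covDeriv)
open B9Eq310DeltaPrime (plaqHolU plaqHolU_one)
open B9Eq310HessianOperator (adTransportW)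
open B9Eq315QTorus (perCfg cornerSite)
open B9Eq315QTower (towerP UlevOf)
open B9Eq315QTowerFlat (perCfg_UlevOf_one_mem_U1 norm_Wcx_UlevOf_one_sub_one_le UlevOf_one)
open B9Eq316TowerFlatIsOneStep (towerP_eq_fineP_pow siteCast)
open B9Eq326OperatorTower (QkW laplaceAk RofUk)
open B9Eq324DeltaPrimeATower (laplacePrimeAk GpOfUk)
open B9Eq3119DeltaPiTower (laplaceAkPi)
open B9Eq368TowerProjLadderClosed (exists_hasMajorant_RofUk_sub_flat_closed)
open B9Eq368TowerProjWordGradientLetters (exists_gradLetter_RofUk_sub_flat exists_gradLetter_W_one tdist_le_tdist1)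
open B9Eq325RofUkSupRowClosed (exists_local_letters_GpOfUk_RofUk)
open B9Eq342MajorantReadingSeam (blockRowW_of_hasMajorant_conj_readA)
open B9Eq352DivFormLetters (conj_sub)
open B9Eq324PenaltyKernelForm (readA_sub)
open B9Eq341TowerBlockGeometry (towerGeom dist_towerGeom blkK_eq_blockCoord_siteCast)
open B9Eq357QprimeTowerKernelForm (blkK)
open B9Thm34Ext (toB6)
open B9Eq349BlockMultipliers (exists_block_clm_family)
open B9Eq342GreenPrimeDstarValueRowTower (exists_valueRow_GpOfUk_covDiv)
open B9Eq343GreenPrimeDstarTwoBackgroundHolderLetter (exists_letters_GpOfUk_covDiv_sub_flat)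
open B9Eq340WeightedHolderRowsProjectionStep (weighted_row_of_local weightedHolderRows_sub_of_localLetters)
open B9Eq340HolderRowOfGradientRow (holderRow_of_gradientRow)

variable {d : ℕ} (hd : 1 ≤ d) (L : ℕ) [NeZero L] (hL : 1 ≤ L) (hL3 : 3 ≤ L)
  {𝔸 : Type*} [NormedRing 𝔸] [NormedAlgebra ℂ 𝔸] [CompleteSpace 𝔸] [NormOneClass 𝔸] [StarRing 𝔸] [NormedStarGroup 𝔸] [StarModule ℂ 𝔸] [FiniteDimensional ℂ 𝔸]
  {W : Type*} [NormedAddCommGroup W] [InnerProductSpace ℂ W] [FiniteDimensional ℂ W] (φ : W ≃ₗ[ℂ] 𝔸)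
  {Mφ Mφ' : ℝ} (hMφ : 0 ≤ Mφ) (hMφ' : 0 ≤ Mφ') (hφ : ∀ w, ‖φ w‖ ≤ Mφ * ‖w‖) (hφ' : ∀ X, ‖φ.symm X‖ ≤ Mφ' * ‖X‖)
  {a : ℝ} (ha : 0 < a) {a' : ℝ} (ha' : 0 < a') {ϱ : ℝ} (hϱ0 : 0 ≤ ϱ) (hϱ1 : ϱ < 1)
  (τ : 𝔸 →ₗ[ℂ] ℂ) {Cτ : ℝ} (hτ : ∀ X, ‖τ X‖ ≤ Cτ * ‖X‖) (hCτ : 0 ≤ Cτ) {Mτ : ℝ} (hMτ : 0 ≤ Mτ)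
  {ρw : ℝ} (hρw : 0 ≤ ρw)
  (hτ₁ : ∀ X : 𝔸, τ (star X) = conj (τ X)) (hτ₂ : ∀ X Y : 𝔸, τ (X * Y) = τ (Y * X)) (hφτ : ∀ X Y : 𝔸, ⟪φ.symm X, φ.symm Y⟫_ℂ = τ (star X * Y))
  (AQ : ℝ)
  {ι : Type} [Fintype ι] [DecidableEq ι] (b : Module.Basis ι ℝ 𝔸) {M₂ : ℝ} (hM₂ : 0 ≤ M₂) (hrepr : ∀ (v : 𝔸) (i : ι), |b.repr v i| ≤ M₂ * ‖v‖)

include hd hL hL3 hMφ hMφ' hφ hφ' ha ha' hϱ0 hϱ1 hτ hCτ hMτ hρw hτ₁ hτ₂ hφτ hM₂ hrepr in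
set_option maxHeartbeats 6400000 in
set_option maxRecDepth 8192 in
/-- **THE INNER SITE FUNCTION `ω = R_kG′_kD*_U f` OF THE THIRD WORD, TWO-BACKGROUND LADDER AT THE FLAT BASE, η-HÖLDER MEMBER** (`Hω` of
`B9Eq3152ThirdWordPiTwoBackgroundGradLetterOfOmegaHolder`, verbatim) — see the module docstring. [folklore]
[cite: Balaban1985BackgroundPropagators, (3.152)–(3.153) p.426, (3.25) p.394, (3.68) p.403, Thm 3.4 p.400, Thm 3.1 (3.40)–(3.43), (3.47) pp.397–398; Balaban1985Variational, (117) p.295] -/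
theorem exists_holderLetter_RkGpDstar_sub_flat :
    ∃ α₁ j₁ K κ : ℝ, 0 < α₁ ∧ 0 < j₁ ∧ 0 ≤ K ∧ 0 < κ ∧
    ∀ (n : ℕ) (η : ℝ) (_hηL : η * (L : ℝ) ^ (n + 1) = 1) (c₀ c₁ : ℝ) [Fact (0 < c₀)] [Fact (0 < c₁)]
      (_hw : c₀ * ((L : ℝ) ^ (n + 1)) ^ d = c₁) (_hρ : |η| ^ d / c₀ ≤ ρw) (m : Fin d → ℕ) [∀ i, NeZero (m i)] (_hm : ∀ i, 1 ≤ m i)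
      (U : Bond d (towerP L m (n + 1)) → 𝔸ˣ) (αU : ℕ → ℝ) (_hα0 : ∀ j, 0 ≤ αU j) (hα1 : ∀ j, αU j ≤ 1 / 64)
      (_hαL : ∀ j, 50 * (d + 1) * αU j * (L : ℝ) ^ d ≤ 1 / 2)
      (hU1 : ∀ (j : ℕ) (x : B7Prop1Explicit.Site d) (k : Fin d), perCfg (towerP L m (j + 1)) (UlevOf L m (n + 1) U j) x k ∈ U1 𝔸)
      (hreg : ∀ (j : ℕ) (y : TSite d (towerP L m j)) (k : Fin d) (ρ' : Fin d → Fin L),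
        ‖((Wcx L (perCfg (towerP L m (j + 1)) (UlevOf L m (n + 1) U j)) (cornerSite L y) k (boxVec L ρ') : 𝔸ˣ) : 𝔸) - 1‖ ≤ αU j)
      (εU : ℕ → ℝ) (_hεU : ∀ j, 0 ≤ εU j) (_hε1 : ∀ j, εU j ≤ 1) (_hUε : ∀ (j : ℕ) (b : Bond d (towerP L m (j + 1))), ‖(UlevOf L m (n + 1) U j b : 𝔸) - 1‖ ≤ εU j)
      (_hLb : ∀ (j : ℕ) (b : Bond d (towerP L m (j + 1))), UlevOf L m (n + 1) U j b ∈ U1 𝔸)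
      (α : ℝ) (_hα : 0 ≤ α) (_hαle : α ≤ α₁)
      (hUst : ∀ b, star (U b : 𝔸) = (((U b)⁻¹ : 𝔸ˣ) : 𝔸)) (_hUb : ∀ b, U b ∈ U1 𝔸) (_hUη : ∀ b, ‖(U b : 𝔸) - 1‖ ≤ α * η)
      (_hUw : ∀ (x : TSite d (towerP L m (n + 1))) (μ ν : Fin d), ‖(U (shift ν x, μ) : 𝔸) - (U (x, μ) : 𝔸)‖ ≤ α * η ^ 2)
      (_hpl : ∀ p : B9SectCLatticeCarrier.Plaq d (towerP L m (n + 1)), ‖(plaqHolU U p : 𝔸) - 1‖ ≤ α * η ^ 2)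
      (_hUgrad : ∀ (x : TSite d (towerP L m (n + 1))) (μ : Fin d), ‖(U (x, μ) : 𝔸) - U (unshift μ x, μ)‖ ≤ α * η ^ 2)
      (_hRlev : ∀ (j : ℕ) (b : Bond d (towerP L m (j + 1))) (w : W), ‖adTransportW φ (UlevOf L m (n + 1) U j) b w‖ ≤ ‖w‖)
      (_hεg : ∀ j < n + 1, εU j ≤ α * ϱ ^ j) (_hAQ : ∑ j ∈ Finset.range (n + 1), αU j ≤ AQ)
      (hpos' : ∀ x : SiteL2K ℂ d (towerP L m (n + 1)) c₀ W, x ≠ 0 → 0 < RCLike.re ⟪x, laplacePrimeAk L m n φ η U a' (c₁ := c₁) x⟫_ℂ)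
      (hpos : ∀ x : BondL2K ℂ d (towerP L m (n + 1)) c₀ W, x ≠ 0 →
        0 < RCLike.re ⟪x, laplaceAk L m n φ η U hL αU hα1 hU1 hreg τ (c₀ := c₀) (c₁ := c₁) a x⟫_ℂ)
      (_hc₀η : c₀ = η ^ d) (j₀ : ℝ) (_hJ : ∀ μ y, ‖B9Eq39Adjoint.J (fun μ => B9Eq33CovDerivVector.shiftEquiv μ) (fun μ y => U (y, μ)) η μ y‖ ≤ j₀) (_hj : j₀ ≤ j₁)
      (hposπ : ∀ x : BondL2K ℂ d (towerP L m (n + 1)) c₀ W, x ≠ 0 →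
        0 < RCLike.re ⟪x, laplaceAkPi L m n φ τ η U a' hpos' hL αU hα1 hU1 hreg (c₁ := c₁) a x⟫_ℂ)
      (_hQ : Function.Surjective (QkW L m n φ U hL αU hα1 hU1 hreg (c₀ := c₀) (c₁ := c₁)))
      (hpos'₁ : ∀ x : SiteL2K ℂ d (towerP L m (n + 1)) c₀ W, x ≠ 0 →
        0 < RCLike.re ⟪x, laplacePrimeAk L m n φ η (fun _ : Bond d (towerP L m (n + 1)) => (1 : 𝔸ˣ)) a' (c₁ := c₁) x⟫_ℂ)
      (hpos₁ : ∀ x : BondL2K ℂ d (towerP L m (n + 1)) c₀ W, x ≠ 0 →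
        0 < RCLike.re ⟪x, laplaceAk L m n φ η (fun _ : Bond d (towerP L m (n + 1)) => (1 : 𝔸ˣ)) hL (fun _ => 0) (fun _ => by norm_num)
          (perCfg_UlevOf_one_mem_U1 L m (n + 1)) (norm_Wcx_UlevOf_one_sub_one_le L m (n + 1) (fun _ => 0) (fun _ => le_rfl)) τ
          (c₀ := c₀) (c₁ := c₁) a x⟫_ℂ)
      (v : TSite d m) (f : BondL2K ℂ d (towerP L m (n + 1)) c₀ W) (F : ℝ)
      (_hfv : ∀ b', blockCoord (L ^ (n + 1)) m (siteCast (towerP_eq_fineP_pow L m (n + 1)) (bpos b')) ≠ v → WL2.equiv ℂ (fun _ : Bond d (towerP L m (n + 1)) => c₀) W f b' = 0)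
      (_hfF : ∀ b', ‖WL2.equiv ℂ (fun _ : Bond d (towerP L m (n + 1)) => c₀) W f b'‖ ≤ F) (y y' : TSite d (towerP L m (n + 1)))
      (_hyy : tdist (towerP L m (n + 1)) y y' ≤ (L : ℝ) ^ (n + 1)),
      ‖WL2.equiv ℂ (fun _ : TSite d (towerP L m (n + 1)) => c₀) W
          (RofUk L m n φ η U (c₀ := c₀) (GpOfUk L m n φ η U a' (c₁ := c₁) hpos' (covDivL2K ℂ c₀ ((η : ℂ))⁻¹ (adTransportW φ fun bb => (U bb)⁻¹) f)) -
            RofUk L m n φ η (fun _ : Bond d (towerP L m (n + 1)) => (1 : 𝔸ˣ)) (c₀ := c₀)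
              (GpOfUk L m n φ η (fun _ : Bond d (towerP L m (n + 1)) => (1 : 𝔸ˣ)) a' (c₁ := c₁) hpos'₁
                (covDivL2K ℂ c₀ ((η : ℂ))⁻¹ (adTransportW φ fun bb => ((fun _ : Bond d (towerP L m (n + 1)) => (1 : 𝔸ˣ)) bb)⁻¹) f))) y' -
        WL2.equiv ℂ (fun _ : TSite d (towerP L m (n + 1)) => c₀) W
          (RofUk L m n φ η U (c₀ := c₀) (GpOfUk L m n φ η U a' (c₁ := c₁) hpos' (covDivL2K ℂ c₀ ((η : ℂ))⁻¹ (adTransportW φ fun bb => (U bb)⁻¹) f)) -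
            RofUk L m n φ η (fun _ : Bond d (towerP L m (n + 1)) => (1 : 𝔸ˣ)) (c₀ := c₀)
              (GpOfUk L m n φ η (fun _ : Bond d (towerP L m (n + 1)) => (1 : 𝔸ˣ)) a' (c₁ := c₁) hpos'₁
                (covDivL2K ℂ c₀ ((η : ℂ))⁻¹ (adTransportW φ fun bb => ((fun _ : Bond d (towerP L m (n + 1)) => (1 : 𝔸ˣ)) bb)⁻¹) f))) y‖ ≤
        (j₀ + α) * K * Real.exp (-(κ * tdist m (blockCoord (L ^ (n + 1)) m (siteCast (towerP_eq_fineP_pow L m (n + 1)) y)) v)) *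
          (tdist (towerP L m (n + 1)) y y' / (L : ℝ) ^ (n + 1)) ^ ((1 : ℝ) / 2) * F := by
  classical
  -- (0) the suppliers, `∃`-first
  obtain ⟨αy, Ky, κy, hαy, hKy, hκy, HY⟩ := exists_letters_GpOfUk_covDiv_sub_flat L hL3 φ hMφ hMφ' hφ hφ' ha' hϱ0 hϱ1 τ hτ₂ hφτ hd
  obtain ⟨αv, Bv, δv, hαv, hBv, hδv, HV⟩ := exists_valueRow_GpOfUk_covDiv L hL3 φ hMφ hMφ' hφ hφ' ha' hϱ0 hϱ1 τ hτ₂ hφτ hd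
  obtain ⟨αR, KR, δR, hαR, hKR, hδR, HR⟩ :=
    exists_hasMajorant_RofUk_sub_flat_closed L φ hMφ hMφ' hφ hφ' ha ha' hϱ0 hϱ1 τ hτ hCτ hρw hτ₁ hτ₂ hφτ hMτ b hM₂ hrepr hd hL hL3
  obtain ⟨αG, KG, δG, hαG, hKG, hδG, HG⟩ :=
    exists_gradLetter_RofUk_sub_flat L φ hMφ hMφ' hφ hφ' ha ha' hϱ0 hϱ1 τ hτ hCτ hρw hτ₁ hτ₂ hφτ hMτ b hM₂ hrepr hd hL hL3
  obtain ⟨KW, δW, hKW, hδW, HW⟩ :=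
    exists_gradLetter_W_one L φ hMφ hMφ' hφ hφ' ha ha' hϱ0 hϱ1 τ hτ hCτ hρw hτ₁ hτ₂ hφτ hMτ b hM₂ hrepr hd hL hL3
  obtain ⟨αO, BO, δO, hαO, hBO, hδO, HO⟩ :=
    exists_local_letters_GpOfUk_RofUk hd L hL hL3 φ hMφ hMφ' hφ hφ' ha ha' hϱ0 hϱ1 τ hτ hCτ hMτ hρw hτ₁ hτ₂ hφτ AQ
  have hSb : 0 ≤ ∑ i, ‖b i‖ := Finset.sum_nonneg fun i _ => norm_nonneg _
  obtain ⟨hd1, hd0⟩ : (1 : ℝ) ≤ d ∧ (0 : ℝ) ≤ d := ⟨by exact_mod_cast hd, Nat.cast_nonneg d⟩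
  -- the rates: `κX` for `X = W_k(1)`, `κT` for `T = R_k(U) − R_k(1)`, the output rates `δA`, `δB`, the final rate `κf`
  obtain ⟨κX, hκX⟩ : ∃ κ : ℝ, κ = min δO δW := ⟨_, rfl⟩
  obtain ⟨κT, hκT⟩ : ∃ κ : ℝ, κ = min δR δG := ⟨_, rfl⟩
  have hκX0 : 0 < κX := by rw [hκX]; exact lt_min hδO hδW
  have hκT0 : 0 < κT := by rw [hκT]; exact lt_min hδR hδG
  obtain ⟨hκXO, hκXW, hκTR, hκTG⟩ : κX ≤ δO ∧ κX ≤ δW ∧ κT ≤ δR ∧ κT ≤ δG :=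
    ⟨by rw [hκX]; exact min_le_left _ _, by rw [hκX]; exact min_le_right _ _, by rw [hκT]; exact min_le_left _ _, by rw [hκT]; exact min_le_right _ _⟩
  obtain ⟨δA, hδA⟩ : ∃ δ : ℝ, δ = min κy (κX / 2) := ⟨_, rfl⟩
  obtain ⟨δB, hδB⟩ : ∃ δ : ℝ, δ = min δv (κT / 2) := ⟨_, rfl⟩
  have hδA0 : 0 < δA := by rw [hδA]; exact lt_min hκy (half_pos hκX0)
  have hδB0 : 0 < δB := by rw [hδB]; exact lt_min hδv (half_pos hκT0)
  obtain ⟨hδBv, hδBκ, hδAκ⟩ : δB ≤ δv ∧ δB < κT ∧ δA < κX :=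
    ⟨by rw [hδB]; exact min_le_left _ _, by rw [hδB]; exact (min_le_right _ _).trans_lt (half_lt_self hκT0),
      by rw [hδA]; exact (min_le_right _ _).trans_lt (half_lt_self hκX0)⟩
  obtain ⟨κf, hκf⟩ : ∃ κ : ℝ, κ = min δA δB := ⟨_, rfl⟩
  have hκf0 : 0 < κf := by rw [hκf]; exact lt_min hδA0 hδB0
  obtain ⟨hκfA, hκfB⟩ : κf ≤ δA ∧ κf ≤ δB := ⟨by rw [hκf]; exact min_le_left _ _, by rw [hκf]; exact min_le_right _ _⟩
  -- the sizes
  obtain ⟨BX, hBX⟩ : ∃ B : ℝ, B = 1 + BO + KW := ⟨_, rfl⟩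
  obtain ⟨KR', hKR'⟩ : ∃ B : ℝ, B = Mφ' * Mφ * ((∑ i, ‖b i‖) * M₂ * KR) := ⟨_, rfl⟩
  obtain ⟨BT, hBT⟩ : ∃ B : ℝ, B = KR' + KG := ⟨_, rfl⟩
  obtain ⟨hBX0, hKR'0, hBT0⟩ : 0 ≤ BX ∧ 0 ≤ KR' ∧ 0 ≤ BT := ⟨by rw [hBX]; positivity, by rw [hKR']; positivity, by rw [hBT, hKR']; positivity⟩
  have hcA : 0 ≤ latticeConst d (κX - δA) := latticeConst_nonneg d (by linarith)
  have hcB : 0 ≤ latticeConst d (κT - δB) := latticeConst_nonneg d (by linarith)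
  obtain ⟨NA, hNA⟩ : ∃ B : ℝ, B = BX * latticeConst d (κX - δA) * Ky := ⟨_, rfl⟩
  obtain ⟨NB, hNB⟩ : ∃ B : ℝ, B = BT * latticeConst d (κT - δB) * Bv := ⟨_, rfl⟩
  obtain ⟨hNA0, hNB0⟩ : 0 ≤ NA ∧ 0 ≤ NB := ⟨by rw [hNA]; positivity, by rw [hNB]; positivity⟩
  obtain ⟨Kf, hKf⟩ : ∃ B : ℝ, B = Ky + d * NA * Real.exp δA + d * NB * Real.exp δB := ⟨_, rfl⟩
  have hKf0 : 0 ≤ Kf := by rw [hKf]; positivity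
  refine ⟨min (min αy αv) (min αR αG), 1, Kf, κf, lt_min (lt_min hαy hαv) (lt_min hαR hαG), one_pos, hKf0, hκf0, ?_⟩
  intro n η hηL c₀ c₁ _ _ hw hρ m _ hm U αU hα0 hα1 _hαL hU1 hreg εU hεU hε1 hUε hLb α hα hαle hUst hUb hUη hUw hpl hUgrad hRlev hεg hAQ
    hpos' _hpos _hc₀η j₀ hJ _hj _hposπ _hQ hpos'₁ _hpos₁ v f F hfv hfF y y' hyy
  obtain ⟨hαy', hαv', hαR', hαG'⟩ : α ≤ αy ∧ α ≤ αv ∧ α ≤ αR ∧ α ≤ αG :=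
    ⟨hαle.trans ((min_le_left _ _).trans (min_le_left _ _)), hαle.trans ((min_le_left _ _).trans (min_le_right _ _)),
      hαle.trans ((min_le_right _ _).trans (min_le_left _ _)), hαle.trans ((min_le_right _ _).trans (min_le_right _ _))⟩
  have hF : 0 ≤ F := (norm_nonneg _).trans (hfF (y, ⟨0, hd⟩))
  have hj₀ : 0 ≤ j₀ := (norm_nonneg _).trans (hJ ⟨0, hd⟩ y)
  have hAQ0 : 0 ≤ AQ := (Finset.sum_nonneg fun j _ => hα0 j).trans hAQ
  haveI : NeZero (L ^ (n + 1)) := ⟨pow_ne_zero _ (NeZero.ne L)⟩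
  have hK1 : (1 : ℝ) ≤ (L : ℝ) ^ (n + 1) := one_le_pow₀ (by exact_mod_cast hL)
  have hK0 : (0 : ℝ) < (L : ℝ) ^ (n + 1) := lt_of_lt_of_le one_pos hK1
  have hη0 : 0 < η := by nlinarith only [hηL, hK0]
  have hKnat : (((L ^ (n + 1) : ℕ)) : ℝ) = (L : ℝ) ^ (n + 1) := by push_cast; rfl
  have hηK : η * (((L ^ (n + 1) : ℕ)) : ℝ) = 1 := by rw [hKnat]; exact hηL
  have hweak : ∀ {κ₁ κ₂ : ℝ} (t : ℝ), κ₁ ≤ κ₂ → 0 ≤ t → Real.exp (-(κ₂ * t)) ≤ Real.exp (-(κ₁ * t)) := fun t h ht =>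
    Real.exp_le_exp.mpr (by nlinarith)
  -- the flat class data
  have hUε1 : ∀ (j : ℕ) (b' : Bond d (towerP L m (j + 1))), ‖(UlevOf L m (n + 1) (fun _ : Bond d (towerP L m (n + 1)) => (1 : 𝔸ˣ)) j b' : 𝔸) - 1‖ ≤ (fun _ : ℕ => (0 : ℝ)) j :=
    fun j b' => by rw [UlevOf_one]; simp
  have hLb1 : ∀ (j : ℕ) (b' : Bond d (towerP L m (j + 1))), UlevOf L m (n + 1) (fun _ : Bond d (towerP L m (n + 1)) => (1 : 𝔸ˣ)) j b' ∈ U1 𝔸 := fun j b' => by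
    rw [UlevOf_one]; exact one_mem _
  have hRlev1 : ∀ (j : ℕ) (b' : Bond d (towerP L m (j + 1))) (w : W), ‖adTransportW φ (UlevOf L m (n + 1) (fun _ : Bond d (towerP L m (n + 1)) => (1 : 𝔸ˣ)) j) b' w‖ ≤ ‖w‖ :=
    fun j b' w => by rw [UlevOf_one, B5Eq172HodgePositivity.adTransportW_one, LinearMap.id_apply]
  have hUst1 : ∀ b' : Bond d (towerP L m (n + 1)), star ((fun _ : Bond d (towerP L m (n + 1)) => (1 : 𝔸ˣ)) b' : 𝔸) =
      ((((fun _ : Bond d (towerP L m (n + 1)) => (1 : 𝔸ˣ)) b')⁻¹ : 𝔸ˣ) : 𝔸) := fun _ => by simp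
  have hUb1 : ∀ b' : Bond d (towerP L m (n + 1)), (fun _ : Bond d (towerP L m (n + 1)) => (1 : 𝔸ˣ)) b' ∈ U1 𝔸 := fun _ => one_mem _
  have hUη1 : ∀ b' : Bond d (towerP L m (n + 1)), ‖(((fun _ : Bond d (towerP L m (n + 1)) => (1 : 𝔸ˣ)) b' : 𝔸ˣ) : 𝔸) - 1‖ ≤ 0 * η := fun _ => by simp
  have hpl1 : ∀ p : B9SectCLatticeCarrier.Plaq d (towerP L m (n + 1)), ‖(plaqHolU (fun _ : Bond d (towerP L m (n + 1)) => (1 : 𝔸ˣ)) p : 𝔸) - 1‖ ≤ 0 * η ^ 2 := fun _ => by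
    simp [plaqHolU_one]
  have hUgrad1 : ∀ (x : TSite d (towerP L m (n + 1))) (μ : Fin d), ‖(((fun _ : Bond d (towerP L m (n + 1)) => (1 : 𝔸ˣ)) (x, μ) : 𝔸ˣ) : 𝔸) -
      (fun _ : Bond d (towerP L m (n + 1)) => (1 : 𝔸ˣ)) (unshift μ x, μ)‖ ≤ 0 * η ^ 2 := fun _ _ => by simp
  have hεg1 : ∀ j < n + 1, (fun _ : ℕ => (0 : ℝ)) j ≤ 0 * ϱ ^ j := fun _ _ => by simp
  have hAQ1 : ∑ j ∈ Finset.range (n + 1), (fun _ : ℕ => (0 : ℝ)) j ≤ AQ := by simpa using hAQ0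
  -- the block cut-off family on the coarse sites (displayed binder of the ladder rows)
  obtain ⟨rr, hrr⟩ := exists_block_clm_family (𝕜 := ℂ) (w := fun _ : TSite d m => c₁) (V := W) (id : TSite d m → TSite d m)
  -- names
  set piS : TSite d (towerP L m (n + 1)) → TSite d m := fun x => blockCoord (L ^ (n + 1)) m (siteCast (towerP_eq_fineP_pow L m (n + 1)) x) with hpiS
  set RU := RofUk L m n φ η U (c₀ := c₀) with hRU
  set R1 := RofUk L m n φ η (fun _ : Bond d (towerP L m (n + 1)) => (1 : 𝔸ˣ)) (c₀ := c₀) with hR1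
  set DsU := covDivL2K ℂ c₀ ((η : ℂ))⁻¹ (adTransportW φ fun bb => (U bb)⁻¹) with hDsU
  set Ds1 := covDivL2K ℂ c₀ ((η : ℂ))⁻¹ (adTransportW φ fun bb => ((fun _ : Bond d (towerP L m (n + 1)) => (1 : 𝔸ˣ)) bb)⁻¹) with hDs1
  obtain ⟨yU, hyU⟩ : ∃ z : SiteL2K ℂ d (towerP L m (n + 1)) c₀ W, z = GpOfUk L m n φ η U a' (c₁ := c₁) hpos' (DsU f) := ⟨_, rfl⟩
  obtain ⟨y1, hy1⟩ : ∃ z : SiteL2K ℂ d (towerP L m (n + 1)) c₀ W,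
      z = GpOfUk L m n φ η (fun _ : Bond d (towerP L m (n + 1)) => (1 : 𝔸ˣ)) a' (c₁ := c₁) hpos'₁ (Ds1 f) := ⟨_, rfl⟩
  obtain ⟨νB, hνB⟩ : ∃ g : TSite d (towerP L m (n + 1)) → W, g = WL2.equiv ℂ (fun _ : TSite d (towerP L m (n + 1)) => c₀) W yU := ⟨_, rfl⟩
  obtain ⟨ν, hν⟩ : ∃ g : TSite d (towerP L m (n + 1)) → W, g = WL2.equiv ℂ (fun _ : TSite d (towerP L m (n + 1)) => c₀) W (yU - y1) := ⟨_, rfl⟩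
  -- the operators `X = W_k(1) = 1 − R_k(1)` and `T = R_k(U) − R_k(1)` read on the site functions
  obtain ⟨X, hX⟩ : ∃ X : (TSite d (towerP L m (n + 1)) → W) →ₗ[ℂ] (TSite d (towerP L m (n + 1)) → W), ∀ g x, X g x =
      WL2.equiv ℂ (fun _ : TSite d (towerP L m (n + 1)) => c₀) W (((LinearMap.id : SiteL2K ℂ d (towerP L m (n + 1)) c₀ W →ₗ[ℂ] SiteL2K ℂ d (towerP L m (n + 1)) c₀ W) - R1) ((WL2.equiv ℂ (fun _ : TSite d (towerP L m (n + 1)) => c₀) W).symm g)) x :=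
    ⟨(WL2.linearEquiv ℂ ℂ (fun _ : TSite d (towerP L m (n + 1)) => c₀)).toLinearMap ∘ₗ ((LinearMap.id : SiteL2K ℂ d (towerP L m (n + 1)) c₀ W →ₗ[ℂ] SiteL2K ℂ d (towerP L m (n + 1)) c₀ W) - R1) ∘ₗ
      (WL2.linearEquiv ℂ ℂ (fun _ : TSite d (towerP L m (n + 1)) => c₀)).symm.toLinearMap, fun _ _ => rfl⟩
  obtain ⟨T, hT⟩ : ∃ T : (TSite d (towerP L m (n + 1)) → W) →ₗ[ℂ] (TSite d (towerP L m (n + 1)) → W), ∀ g x, T g x =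
      WL2.equiv ℂ (fun _ : TSite d (towerP L m (n + 1)) => c₀) W ((RU - R1) ((WL2.equiv ℂ (fun _ : TSite d (towerP L m (n + 1)) => c₀) W).symm g)) x :=
    ⟨(WL2.linearEquiv ℂ ℂ (fun _ : TSite d (towerP L m (n + 1)) => c₀)).toLinearMap ∘ₗ (RU - R1) ∘ₗ
      (WL2.linearEquiv ℂ ℂ (fun _ : TSite d (towerP L m (n + 1)) => c₀)).symm.toLinearMap, fun _ _ => rfl⟩
  -- (1) THE LOCAL LETTERS of `X` (value: ne9-leaf-05's `R_k(1)` letter; flat gradient: `exists_gradLetter_W_one`)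
  have hXv : ∀ (v' : TSite d m) (g : TSite d (towerP L m (n + 1)) → W) (G : ℝ), (∀ z, piS z ≠ v' → g z = 0) → (∀ z, ‖g z‖ ≤ G) →
      ∀ x, ‖X g x‖ ≤ BX * Real.exp (-(κX * tdist m (piS x) v')) * G := by
    intro v' g G hgv' hgG x
    have hG : 0 ≤ G := (norm_nonneg _).trans (hgG x)
    rw [hX, LinearMap.sub_apply, LinearMap.id_apply, WL2.equiv_sub, Pi.sub_apply, Equiv.apply_symm_apply]
    have h1 : ‖g x‖ ≤ Real.exp (-(κX * tdist m (piS x) v')) * G := by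
      by_cases hx : piS x = v'
      · rw [hx, tdist_self, mul_zero, neg_zero, Real.exp_zero, one_mul]; exact hgG x
      · rw [hgv' x hx, norm_zero]; positivity
    have h2 : ‖WL2.equiv ℂ (fun _ : TSite d (towerP L m (n + 1)) => c₀) W (R1 ((WL2.equiv ℂ (fun _ : TSite d (towerP L m (n + 1)) => c₀) W).symm g)) x‖ ≤
        BO * Real.exp (-(κX * tdist m (piS x) v')) * G := by
      refine ((HO n η hηL c₀ c₁ hw hρ m hm (fun _ : Bond d (towerP L m (n + 1)) => (1 : 𝔸ˣ)) (fun _ => 0) (fun _ => le_rfl) (fun _ => by norm_num)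
        (perCfg_UlevOf_one_mem_U1 L m (n + 1)) (norm_Wcx_UlevOf_one_sub_one_le L m (n + 1) (fun _ => 0) (fun _ => le_rfl)) (fun _ => 0) (fun _ => le_rfl) hUε1 hLb1
        0 le_rfl hαO.le hUst1 hUb1 hUη1 hpl1 hUgrad1 hRlev1 hεg1 hAQ1 hpos'₁ v' ((WL2.equiv ℂ (fun _ : TSite d (towerP L m (n + 1)) => c₀) W).symm g) G
        (fun z hz => by rw [Equiv.apply_symm_apply]; exact hgv' z hz) (fun z => by rw [Equiv.apply_symm_apply]; exact hgG z) x).2.1).trans ?_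
      exact mul_le_mul_of_nonneg_right (mul_le_mul_of_nonneg_left (hweak _ hκXO (tdist_nonneg m _ _)) hBO) hG
    refine (norm_sub_le _ _).trans ((add_le_add h1 h2).trans ?_)
    rw [hBX]; nlinarith [Real.exp_nonneg (-(κX * tdist m (piS x) v')), hKW, hG, mul_nonneg (mul_nonneg hKW (Real.exp_nonneg (-(κX * tdist m (piS x) v')))) hG]
  have hXg : ∀ (v' : TSite d m) (g : TSite d (towerP L m (n + 1)) → W) (G : ℝ), (∀ z, piS z ≠ v' → g z = 0) → (∀ z, ‖g z‖ ≤ G) →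
      ∀ bb : Bond d (towerP L m (n + 1)), ‖covDeriv ((η : ℂ))⁻¹ (adTransportW φ (fun _ : Bond d (towerP L m (n + 1)) => (1 : 𝔸ˣ))) (X g) bb‖ ≤
        BX * Real.exp (-(κX * tdist m (piS (bpos bb)) v')) * G := by
    intro v' g G hgv' hgG bb
    have hG : 0 ≤ G := (norm_nonneg _).trans (hgG bb.1)
    have hXg' : X g = WL2.equiv ℂ (fun _ : TSite d (towerP L m (n + 1)) => c₀) W (((LinearMap.id : SiteL2K ℂ d (towerP L m (n + 1)) c₀ W →ₗ[ℂ] SiteL2K ℂ d (towerP L m (n + 1)) c₀ W) - R1) ((WL2.equiv ℂ (fun _ : TSite d (towerP L m (n + 1)) => c₀) W).symm g)) :=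
      funext fun x => hX g x
    rw [hXg', ← equiv_covDerivL2K]
    obtain ⟨x, μ⟩ := bb
    refine (HW n η hηL c₀ c₁ hw hρ m hm hpos'₁ rr hrr v' ((WL2.equiv ℂ (fun _ : TSite d (towerP L m (n + 1)) => c₀) W).symm g) G
      (fun z hz => by rw [Equiv.apply_symm_apply]; exact hgv' z hz) (fun z => by rw [Equiv.apply_symm_apply]; exact hgG z) x μ).trans ?_
    have e1 : Real.exp (-(δW * tdist m (piS x) v')) ≤ Real.exp (-(κX * tdist m (piS x) v')) := hweak _ hκXW (tdist_nonneg m _ _)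
    have hKB : KW ≤ BX := by rw [hBX]; linarith
    calc KW * Real.exp (-(δW * tdist m (piS x) v')) * G ≤ BX * Real.exp (-(κX * tdist m (piS x) v')) * G := by gcongr
      _ = _ := rfl
  -- (2) THE LOCAL LETTERS of `T` (value: the ladder majorant read back; flat gradient: `exists_gradLetter_RofUk_sub_flat`), small factor `α`
  have hTR := HR n η hηL c₀ c₁ hw hρ m hm U α hα hαR' hUb hUη hUw hpl hUst αU hα1 hU1 hreg εU hεU hε1 hεg hUε hLb hRlev hpos' hpos'₁ rr hrr 0 0 True
  rw [← conj_sub, ← readA_sub] at hTR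
  have hTv : ∀ (v' : TSite d m) (g : TSite d (towerP L m (n + 1)) → W) (G : ℝ), (∀ z, piS z ≠ v' → g z = 0) → (∀ z, ‖g z‖ ≤ G) →
      ∀ x, ‖T g x‖ ≤ (BT * α) * Real.exp (-(κT * tdist m (piS x) v')) * G := by
    intro v' g G hgv' hgG x
    have hG : 0 ≤ G := (norm_nonneg _).trans (hgG x)
    have hoff' : ∀ x', blkK L m n x' ≠ v' → WL2.equiv ℂ (fun _ : TSite d (towerP L m (n + 1)) => c₀) W
        ((WL2.equiv ℂ (fun _ : TSite d (towerP L m (n + 1)) => c₀) W).symm g) x' = 0 := fun x' hx' => by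
      rw [Equiv.apply_symm_apply]; exact hgv' x' (by rw [blkK_eq_blockCoord_siteCast] at hx'; exact hx')
    have hbd' : ∀ x', blkK L m n x' = v' → ‖WL2.equiv ℂ (fun _ : TSite d (towerP L m (n + 1)) => c₀) W
        ((WL2.equiv ℂ (fun _ : TSite d (towerP L m (n + 1)) => c₀) W).symm g) x'‖ ≤ G := fun x' _ => by rw [Equiv.apply_symm_apply]; exact hgG x'
    have hrow := blockRowW_of_hasMajorant_conj_readA φ hMφ hMφ' hφ hφ' b hM₂ hrepr (G := toB6 (towerGeom L m n η 0) 0 True) (blkK L m n) _ _ hTR v' _ G hG hoff' hbd' x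
    rw [hT]
    refine hrow.trans ?_
    have hexp : Real.exp (-(δR * (towerGeom L m n η 0).dist (blkK L m n x) v')) ≤ Real.exp (-(κT * tdist m (piS x) v')) := by
      rw [dist_towerGeom, blkK_eq_blockCoord_siteCast]
      refine Real.exp_le_exp.mpr ?_
      have h1 := tdist_le_tdist1 (blockCoord (L ^ (n + 1)) m (siteCast (towerP_eq_fineP_pow L m (n + 1)) x)) v'
      have h2 := tdist_nonneg m (blockCoord (L ^ (n + 1)) m (siteCast (towerP_eq_fineP_pow L m (n + 1)) x)) v'
      nlinarith [mul_le_mul_of_nonneg_right hκTR h2, mul_le_mul_of_nonneg_left h1 hδR.le]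
    have hKB : KR' * α ≤ BT * α := by rw [hBT]; nlinarith
    calc Mφ' * Mφ * ((∑ i, ‖b i‖) * M₂ * (KR * α * Real.exp (-(δR * (towerGeom L m n η 0).dist (blkK L m n x) v')))) * G
        ≤ Mφ' * Mφ * ((∑ i, ‖b i‖) * M₂ * (KR * α * Real.exp (-(κT * tdist m (piS x) v')))) * G := by gcongr
      _ = (KR' * α) * Real.exp (-(κT * tdist m (piS x) v')) * G := by rw [hKR']; ring
      _ ≤ (BT * α) * Real.exp (-(κT * tdist m (piS x) v')) * G := by gcongr
  have hTg : ∀ (v' : TSite d m) (g : TSite d (towerP L m (n + 1)) → W) (G : ℝ), (∀ z, piS z ≠ v' → g z = 0) → (∀ z, ‖g z‖ ≤ G) →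
      ∀ bb : Bond d (towerP L m (n + 1)), ‖covDeriv ((η : ℂ))⁻¹ (adTransportW φ (fun _ : Bond d (towerP L m (n + 1)) => (1 : 𝔸ˣ))) (T g) bb‖ ≤
        (BT * α) * Real.exp (-(κT * tdist m (piS (bpos bb)) v')) * G := by
    intro v' g G hgv' hgG bb
    have hG : 0 ≤ G := (norm_nonneg _).trans (hgG bb.1)
    have hTg' : T g = WL2.equiv ℂ (fun _ : TSite d (towerP L m (n + 1)) => c₀) W ((RU - R1) ((WL2.equiv ℂ (fun _ : TSite d (towerP L m (n + 1)) => c₀) W).symm g)) :=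
      funext fun x => hT g x
    rw [hTg', ← equiv_covDerivL2K]
    obtain ⟨x, μ⟩ := bb
    refine (HG n η hηL c₀ c₁ hw hρ m hm U α hα hαG' hUb hUη hUw hpl hUst αU hα1 hU1 hreg εU hεU hε1 hεg hUε hLb hRlev hpos' hpos'₁ rr hrr v'
      ((WL2.equiv ℂ (fun _ : TSite d (towerP L m (n + 1)) => c₀) W).symm g) G
      (fun z hz => by rw [Equiv.apply_symm_apply]; exact hgv' z hz) (fun z => by rw [Equiv.apply_symm_apply]; exact hgG z) x μ).trans ?_
    have e1 : Real.exp (-(δG * tdist m (piS x) v')) ≤ Real.exp (-(κT * tdist m (piS x) v')) := hweak _ hκTG (tdist_nonneg m _ _)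
    have hKB : KG * α ≤ BT * α := by rw [hBT]; nlinarith
    calc KG * α * Real.exp (-(δG * tdist m (piS x) v')) * G ≤ BT * α * Real.exp (-(κT * tdist m (piS x) v')) * G := by gcongr
      _ = _ := rfl
  -- (3) THE ROWS: `y(U)` (value, decaying from `v`), `y(U) − y(1)` (value + Hölder, factor `α`)
  have hyUv : ∀ x, ‖νB x‖ ≤ Bv * F * Real.exp (-(δv * tdist m (piS x) v)) := fun x => by
    rw [hνB, hyU]
    exact (HV n η hηL c₀ c₁ hw m U α hα hαv' hUb hUη hUgrad εU hεU hεg hUε hLb hUst hRlev hpos' v f F hfv hfF x).trans (le_of_eq (by ring))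
  obtain ⟨hgv, hgh⟩ := HY n η hηL c₀ c₁ hw m U α hα hαy' hUb hUη hUgrad εU hεU hε1 hεg hUε hLb hUst hRlev hpos' hpos'₁ v f F hfv hfF
  have hN : 0 ≤ α * Ky * F := by positivity
  have hAv : ∀ x, ‖ν x‖ ≤ α * Ky * F * Real.exp (-(κy * tdist m (piS x) v)) := fun x => by
    rw [hν, hyU, hy1]; exact (hgv x).trans (le_of_eq (by ring))
  have hAh' : ∀ x x', tdist (towerP L m (n + 1)) x x' ≤ (((L ^ (n + 1) : ℕ)) : ℝ) →
      ‖ν x' - ν x‖ ≤ α * Ky * F * Real.exp (-(κy * tdist m (piS x) v)) * (tdist (towerP L m (n + 1)) x x' / (((L ^ (n + 1) : ℕ)) : ℝ)) ^ ((1 : ℝ) / 2) := by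
    intro x x' hxx
    rw [hKnat] at hxx ⊢; rw [hν, hyU, hy1]; exact (hgh x x' hxx).trans (le_of_eq (by ring))
  -- (4) TERM B `(R_k(U) − R_k(1))y(U)`: weighted value ∕ flat-gradient rows by the local letters, then Hölder (a Lipschitz field at the unit scale is Hölder)
  have hNB' : 0 ≤ BT * α * latticeConst d (κT - δB) * (Bv * F) := by positivity
  have hTBv : ∀ x, ‖T νB x‖ ≤ BT * α * latticeConst d (κT - δB) * (Bv * F) * Real.exp (-(δB * tdist m (piS x) v)) := fun x =>
    weighted_row_of_local (L ^ (n + 1)) m (towerP_eq_fineP_pow L m (n + 1)) hm T piS (mul_nonneg hBT0 hα) (mul_nonneg hBv hF) hδB0.le hδBv hδBκ hTv v νB hyUv x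
  have hTBg : ∀ bb : Bond d (towerP L m (n + 1)), ‖covDeriv ((η : ℂ))⁻¹ (adTransportW φ (fun _ : Bond d (towerP L m (n + 1)) => (1 : 𝔸ˣ))) (T νB) bb‖ ≤
      BT * α * latticeConst d (κT - δB) * (Bv * F) * Real.exp (-(δB * tdist m (piS (bpos bb)) v)) := fun bb => by
    have h := weighted_row_of_local (L ^ (n + 1)) m (towerP_eq_fineP_pow L m (n + 1)) hm
      (covDeriv ((η : ℂ))⁻¹ (adTransportW φ (fun _ : Bond d (towerP L m (n + 1)) => (1 : 𝔸ˣ))) ∘ₗ T) (fun bb => piS (bpos bb)) (BX := BT * α) (N := Bv * F)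
      (mul_nonneg hBT0 hα) (mul_nonneg hBv hF) hδB0.le hδBv hδBκ (fun v' g G hg hG bb => by rw [LinearMap.comp_apply]; exact hTg v' g G hg hG bb) v νB hyUv bb
    rw [LinearMap.comp_apply] at h
    exact h
  have hTBh := holderRow_of_gradientRow (L ^ (n + 1)) m φ hφ hφ' hMφ hMφ' (towerP_eq_fineP_pow L m (n + 1)) hm (fun _ : Bond d (towerP L m (n + 1)) => (1 : 𝔸ˣ))
    hη0 hηK le_rfl hUb1 hUη1 (T νB) v (ε := (1 : ℝ) / 2) hNB' hNB' hδB0.le (by norm_num) hTBv hTBg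
  -- (5) TERM A `R_k(1)(y(U) − y(1)) = ν − Xν`: the projection step in the weighted Hölder currency
  have hHJ := weightedHolderRows_sub_of_localLetters (L ^ (n + 1)) m φ hφ hφ' hMφ hMφ' (towerP_eq_fineP_pow L m (n + 1)) hm
    (fun _ : Bond d (towerP L m (n + 1)) => (1 : 𝔸ˣ)) hη0 hηK le_rfl hUb1 hUη1 X hBX0 hκX0 hXv hXg ν v hN hN hκy.le (by norm_num : (1 : ℝ) / 2 ≤ 1) hAv hAh'
  obtain ⟨-, hAh⟩ := hHJ
  rw [← hδA] at hAh
  -- (6) THE IDENTITY `ω(U) − ω(1) = Ty(U) + (ν − Xν)` and the assembly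
  have hpt : ∀ x, WL2.equiv ℂ (fun _ : TSite d (towerP L m (n + 1)) => c₀) W (RU yU - R1 y1) x = T νB x + (ν - X ν) x := by
    intro x
    rw [Pi.sub_apply, hT, hX, hνB, hν, Equiv.symm_apply_apply, Equiv.symm_apply_apply]
    simp only [LinearMap.sub_apply, LinearMap.id_apply, map_sub, WL2.equiv_sub, Pi.sub_apply]
    abel
  rw [← hyU, ← hy1, hpt, hpt]
  have e : ∀ a₁ b₁ a₂ b₂ : W, a₁ + b₁ - (a₂ + b₂) = (a₁ - a₂) + (b₁ - b₂) := fun _ _ _ _ => by abel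
  rw [e]
  have hyyN : tdist (towerP L m (n + 1)) y y' ≤ (((L ^ (n + 1) : ℕ)) : ℝ) := by rw [hKnat]; exact hyy
  have h1 := hTBh y y' hyyN
  have h2 := hAh y y' hyyN
  rw [hKnat] at h1 h2
  have hs0 : 0 ≤ (tdist (towerP L m (n + 1)) y y' / (L : ℝ) ^ (n + 1)) ^ ((1 : ℝ) / 2) := Real.rpow_nonneg (div_nonneg (tdist_nonneg _ y y') hK0.le) _
  have hw1 : Real.exp (-(δB * tdist m (piS y) v)) ≤ Real.exp (-(κf * tdist m (piS y) v)) := hweak _ hκfB (tdist_nonneg m _ _)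
  have hw2 : Real.exp (-(δA * tdist m (piS y) v)) ≤ Real.exp (-(κf * tdist m (piS y) v)) := hweak _ hκfA (tdist_nonneg m _ _)
  have hEf : 0 ≤ Real.exp (-(κf * tdist m (piS y) v)) := Real.exp_nonneg _
  have hα1' : α * Kf ≤ (j₀ + α) * Kf := by nlinarith
  refine (norm_add_le _ _).trans ?_
  calc ‖T νB y' - T νB y‖ + ‖(ν - X ν) y' - (ν - X ν) y‖
      ≤ d * (BT * α * latticeConst d (κT - δB) * (Bv * F) + 2 * Mφ * Mφ' * 0 * (BT * α * latticeConst d (κT - δB) * (Bv * F))) * Real.exp δB *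
            Real.exp (-(δB * tdist m (piS y) v)) * (tdist (towerP L m (n + 1)) y y' / (L : ℝ) ^ (n + 1)) ^ ((1 : ℝ) / 2) +
          (α * Ky * F + d * (BX * latticeConst d (κX - δA) * (α * Ky * F) + 2 * Mφ * Mφ' * 0 * (BX * latticeConst d (κX - δA) * (α * Ky * F))) * Real.exp δA) *
            Real.exp (-(δA * tdist m (piS y) v)) * (tdist (towerP L m (n + 1)) y y' / (L : ℝ) ^ (n + 1)) ^ ((1 : ℝ) / 2) := add_le_add h1 h2
    _ ≤ d * (BT * α * latticeConst d (κT - δB) * (Bv * F) + 2 * Mφ * Mφ' * 0 * (BT * α * latticeConst d (κT - δB) * (Bv * F))) * Real.exp δB *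
            Real.exp (-(κf * tdist m (piS y) v)) * (tdist (towerP L m (n + 1)) y y' / (L : ℝ) ^ (n + 1)) ^ ((1 : ℝ) / 2) +
          (α * Ky * F + d * (BX * latticeConst d (κX - δA) * (α * Ky * F) + 2 * Mφ * Mφ' * 0 * (BX * latticeConst d (κX - δA) * (α * Ky * F))) * Real.exp δA) *
            Real.exp (-(κf * tdist m (piS y) v)) * (tdist (towerP L m (n + 1)) y y' / (L : ℝ) ^ (n + 1)) ^ ((1 : ℝ) / 2) := by
        have hX1 : 0 ≤ d * (BT * α * latticeConst d (κT - δB) * (Bv * F) + 2 * Mφ * Mφ' * 0 * (BT * α * latticeConst d (κT - δB) * (Bv * F))) * Real.exp δB := by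
          positivity
        have hX2 : 0 ≤ α * Ky * F + d * (BX * latticeConst d (κX - δA) * (α * Ky * F) + 2 * Mφ * Mφ' * 0 * (BX * latticeConst d (κX - δA) * (α * Ky * F))) * Real.exp δA := by
          positivity
        gcongr
    _ = α * (Ky + d * NA * Real.exp δA + d * NB * Real.exp δB) * Real.exp (-(κf * tdist m (piS y) v)) *
          (tdist (towerP L m (n + 1)) y y' / (L : ℝ) ^ (n + 1)) ^ ((1 : ℝ) / 2) * F := by rw [hNA, hNB]; ring
    _ ≤ (j₀ + α) * Kf * Real.exp (-(κf * tdist m (piS y) v)) * (tdist (towerP L m (n + 1)) y y' / (L : ℝ) ^ (n + 1)) ^ ((1 : ℝ) / 2) * F := by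
        rw [← hKf]; gcongr

end Literature.MathematicalPhysics.QuantumFieldTheory.Balaban1983to89.B9Eq3152RkGpDstarPiTwoBackgroundHolderLetter

end
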